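import Summits.AtomisticToContinuum.Crystallization.Theorems.FreeSplittingCertificatesStrictSplittingRuleCoreJointDefs
import Summits.AtomisticToContinuum.Crystallization.Theorems.FreeSplittingCertificatesStrictSplittingRuleCoreFirstOrderDesignGeometry
import Summits.AtomisticToContinuum.Crystallization.Theorems.FreeSplittingCertificatesStrictSplittingRuleFiniteBall
import Summits.AtomisticToContinuum.Crystallization.Theorems.FreeSplittingCertificatesStrictSplittingRuleSummableBare
import Summits.AtomisticToContinuum.Crystallization.Theorems.FreeSplittingCertificatesStrictSplittingRuleSummableTransfer

/-!
# Summability of the readout-form series of the joint certificate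

Helper of reshape r6 (lead c5) of crux `StrictSplittingRule` (stmt-AtomisticToContinuum-12560), line `registered`:
toward any proof of H12⋆ `CoreJointCoercive` (…CoreJointDefs.lean). Registered stub, landed `--supports stmt-AtomisticToContinuum-12560`.
-/

noncomputable section

namespace Summit.AtomisticToContinuum.Crystallization.Theorems.StrictSplittingRuleBirth

open scoped BigOperators Classical
open Literature.MathematicalPhysics.StatisticalMechanics
open Literature.Geometry.DiscreteGeometry
open Summit.AtomisticToContinuum.Crystallization.Theorems.PalmUnimodularRigidity.LayeredLawsSelectHcp
  (hcpSite ljSqDeriv)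

/-- **stub_summableReadoutForm** (r6 helper, glue): for a `(1+r)⁻⁶`-decaying covariant first-order table `β` over a finite
stencil `Y₁`, a finitely supported `u`, any site `p` and any linear `W`, the READOUT-FORM series of `CoreJointSiteIneq`
is summable over `ℤ³` (cofinitely `u (q+s) = u q = 0`, so the summand is `Σ_s [β(b q)(p−q)(s)·½‖W(y_{q+s}−y_q)‖² − β(b p)(q−p)(s)·c_s]`
with `‖y_{q+s} − y_q‖ = ‖y_s‖` or `‖y_{−s}‖`, dominated by `const·(1+‖y_q−y_p‖)⁻⁶` using both decay bounds;
`summableTransfer_summable_weight`). [folklore] -/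
theorem stub_summableReadoutForm : ∀ a h C : ℝ, 0 < a → 0 < h → ∀ (Y₁ : Finset (ℤ × ℤ × ℤ))
    (β : Bool → (ℤ × ℤ × ℤ) → (ℤ × ℤ × ℤ) → ℝ),
    (∀ p q : ℤ × ℤ × ℤ, ∀ s, |β (decide (Even p.1)) (q - p) s| ≤
        C * ((1 + ‖hcpSite a h q - hcpSite a h p‖)⁻¹) ^ 6) →
    ∀ u : ℤ × ℤ × ℤ → EuclideanSpace ℝ (Fin 3), (Function.support u).Finite → ∀ p : ℤ × ℤ × ℤ,
      ∀ W : EuclideanSpace ℝ (Fin 3) →ₗ[ℝ] EuclideanSpace ℝ (Fin 3),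
        Summable fun q : ℤ × ℤ × ℤ => (if q = p then (0 : ℝ) else
          ∑ s ∈ Y₁,
            (β (decide (Even q.1)) (p - q) s *
                (1 / 2 * ‖u (q + s) - u q - W (hcpSite a h (q + s) - hcpSite a h q)‖ ^ 2) -
              β (decide (Even p.1)) (q - p) s *
                (1 / 2 * ‖u (p + s) - u p - W (hcpSite a h (p + s) - hcpSite a h p)‖ ^ 2))) := by
  intro a h C ha hh Y₁ β hβ u hu p W
  refine summableTransfer_guard p (summable_sum fun s _ => Summable.sub ?_ ?_)
  · -- the `q`-indexed product: split off the part carrying `u`, which is finitely supported in `q`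
    have hK : ∀ q : ℤ × ℤ × ℤ, ‖W (hcpSite a h (q + s) - hcpSite a h q)‖ ≤
        ‖W (hcpSite a h s)‖ + ‖W (hcpSite a h (-s))‖ := by
      intro q
      rcases Int.even_or_odd q.1 with hq | hq
      · rw [h1_sub_of_even a h hq s]
        exact le_add_of_nonneg_right (norm_nonneg _)
      · rw [h1_sub_of_odd a h hq s, map_neg, norm_neg]
        exact le_add_of_nonneg_left (norm_nonneg _)
    have hA0 : Summable fun q : ℤ × ℤ × ℤ =>
        β (decide (Even q.1)) (p - q) s * (1 / 2 * ‖W (hcpSite a h (q + s) - hcpSite a h q)‖ ^ 2) := by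
      refine summableTransfer_summable_of_abs_le ha hh p
        (C := C * (1 / 2 * (‖W (hcpSite a h s)‖ + ‖W (hcpSite a h (-s))‖) ^ 2)) fun q => ?_
      have hb : |β (decide (Even q.1)) (p - q) s| ≤
          C * ((1 + ‖hcpSite a h q - hcpSite a h p‖)⁻¹) ^ 6 := by
        have := hβ q p s
        rwa [norm_sub_rev] at this
      have ht0 : 0 ≤ 1 / 2 * ‖W (hcpSite a h (q + s) - hcpSite a h q)‖ ^ 2 := by positivity
      have htK : 1 / 2 * ‖W (hcpSite a h (q + s) - hcpSite a h q)‖ ^ 2 ≤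
          1 / 2 * (‖W (hcpSite a h s)‖ + ‖W (hcpSite a h (-s))‖) ^ 2 := by
        have := hK q
        gcongr
      rw [abs_mul, abs_of_nonneg ht0]
      calc |β (decide (Even q.1)) (p - q) s| * (1 / 2 * ‖W (hcpSite a h (q + s) - hcpSite a h q)‖ ^ 2)
          ≤ C * ((1 + ‖hcpSite a h q - hcpSite a h p‖)⁻¹) ^ 6 *
              (1 / 2 * (‖W (hcpSite a h s)‖ + ‖W (hcpSite a h (-s))‖) ^ 2) :=
            mul_le_mul hb htK ht0 ((abs_nonneg _).trans hb)
        _ = C * (1 / 2 * (‖W (hcpSite a h s)‖ + ‖W (hcpSite a h (-s))‖) ^ 2) *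
              ((1 + ‖hcpSite a h q - hcpSite a h p‖)⁻¹) ^ 6 := by ring
    have hdiff : Summable fun q : ℤ × ℤ × ℤ =>
        β (decide (Even q.1)) (p - q) s *
            (1 / 2 * ‖u (q + s) - u q - W (hcpSite a h (q + s) - hcpSite a h q)‖ ^ 2) -
          β (decide (Even q.1)) (p - q) s *
            (1 / 2 * ‖W (hcpSite a h (q + s) - hcpSite a h q)‖ ^ 2) :=
      summableTransfer_summable_of_vanish hu s fun q h0 h1 => by
        simp only [h0, h1, zero_sub, norm_neg, sub_self]
    exact (hdiff.add hA0).congr fun q => sub_add_cancel _ _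
  · exact (summableTransfer_summable_of_abs_le ha hh p fun q => hβ p q s).mul_right _

end Summit.AtomisticToContinuum.Crystallization.Theorems.StrictSplittingRuleBirth

end
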